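import Mathlib
import Summits.NavierStokesRegularity.NavierStokesRegularity.Theorems.TaoLadderRungTwoBreakOneShiftWindowAmpHull
import Summits.NavierStokesRegularity.NavierStokesRegularity.Theorems.TaoLadderRungTwoBreakOneShiftWindowSensStepD
import HarnessLib

/-!
# The one-shift window system, LXIX: THE TWO-RUN SENSITIVITY CHAIN OVER THE CENTRED GRID — per-step sensitivity
# vectors `pY_s, ZY_s, pT_s, ZT_s` (part LXVIII) LINKED along the grid (`pY_{s+1} ≥ pY_s + ZY_s`,
# `pT_{s+1} ≥ pT_s + ZT_s`), and the theorem that two runs of two TWIN realisations (tails at sup-distance `≤ δ`)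
# from starts `|a − b|_i ≤ pY_{0,i} d` satisfy `|S_u(τ) − S_v(τ)|_i ≤ (pY_s + ZY_s)_i d + (pT_s + ZT_s)_i δ` at every
# time `τ` of every step `s` up to the horizon (cell harvest/h2-tao-ladder, seat p2; rung1/RUNG1-P2G16-REPORT.md §83
# (K2: chained over the grid); support for K1(1) = `NoSurvivingDSSOne`, stmt-NavierStokesRegularity-20205)

MODEL lattice ODEs only (Tao 2016 §4 normal form on Tao's shift set `S`); nothing here is a statement about
the Navier–Stokes equations; no item is closed; no instance is evaluated here. Generic in `ι`, `κ`; COMPUTATIONAL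
(referee P162) once an instance's Booleans are evaluated by `native_decide`.

* `SensD` — the data: four arrays (one vector of `n` dyadics per step); readers `pYf`, `ZYf`, `pTf`, `ZTf`;
* `GridD.sensStepOK sd s` (= part LXVIII `sensOK` of step `s`), `GridD.sensLinkOK sd s` (the two link inequalities);
* `GridCD.abs_start_sub_le_of_gridCE_sens` — the invariant at the grid times;
* **`GridCD.abs_sub_le_of_gridCE_sens`** — the bound at every time of every step up to the horizon `T ∈ [t_S, t_S + h_S]`
  (each run is kept in the step hulls by part LXIV `traj_mem_Hs_of_gridCE` with its own reference run from `P_0`;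
  part LXVIII `abs_sens_le` on the re-clocked runs).
-/

noncomputable section

-- the sub-problem namespace repeats the summit name by design (D-0017)
set_option linter.dupNamespace false

namespace Summit.NavierStokesRegularity.NavierStokesRegularity.Theorems

namespace DSSOneShift

open Set Finset Metric Filter Topology TopologicalSpace
open Literature.Analysis.ODE
open Summit.NavierStokesRegularity.NavierStokesRegularity.Theorems.TaylorModelCert
open Summit.NavierStokesRegularity.NavierStokesRegularity.Theorems.TaylorModelReadout
open Summit.NavierStokesRegularity.NavierStokesRegularity.Theorems.CertificateGlueOn

/-! ### The data -/

/-- **The dyadic sensitivity data of a grid**: per step `s` the four vectors `pY_s, ZY_s, pT_s, ZT_s` of part LXVIII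
(start sensitivities in the point / in the tails at the grid time `t_s`, and their K–Z increments over step `s`).
[cite: KapelaZgliczynski2009, §4 Lemma 8 / Thm. 9; cell vocabulary, harvest/h2-tao-ladder rung1/RUNG1-P2G16-REPORT.md §83 (SensStepD, chained)] -/
structure SensD where
  /-- `pY_s`, one array of `n` dyadics per step -/
  pY : Array (Array Dyad)
  /-- `ZY_s` -/
  ZY : Array (Array Dyad)
  /-- `pT_s` -/
  pT : Array (Array Dyad)
  /-- `ZT_s` -/
  ZT : Array (Array Dyad)

namespace SensD

variable (sd : SensD)

/-- Reader of a per-step vector (junk `0`). [folklore] -/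
def vget (A : Array (Array Dyad)) (s i : ℕ) : Dyad :=
  if h : s < A.size then RoughStepD.dget A[s] i else Dyad.ofInt 0

/-- `pY_s` as a function. [folklore] -/
def pYf (s : ℕ) : ℕ → Dyad := vget sd.pY s
/-- `ZY_s` as a function. [folklore] -/
def ZYf (s : ℕ) : ℕ → Dyad := vget sd.ZY s
/-- `pT_s` as a function. [folklore] -/
def pTf (s : ℕ) : ℕ → Dyad := vget sd.pT s
/-- `ZT_s` as a function. [folklore] -/
def ZTf (s : ℕ) : ℕ → Dyad := vget sd.ZT s

end SensD

namespace GridD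

variable (g : GridD) (sd : SensD)

/-- The sensitivity test of step `s` (part LXVIII `PairStepD.sensOK`). [cite: KapelaZgliczynski2009, §4 Lemma 8 / Thm. 9] -/
def sensStepOK (s : ℕ) : Bool := (g.step s).sensOK (sd.pYf s) (sd.ZYf s) (sd.pTf s) (sd.ZTf s)

/-- The link test `pY_{s+1} ≥ pY_s + ZY_s`, `pT_{s+1} ≥ pT_s + ZT_s`. [cite: Moore1979, §8.1 eq. (8.13) (continuation over steps); cell vocabulary, harvest/h2-tao-ladder rung1/RUNG1-P2G16-REPORT.md §83 (pb_{s+1} = pb_s + Ẑb_s)] -/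
def sensLinkOK (s : ℕ) : Bool :=
  (List.range g.n).all fun i =>
    Dyad.ble ((sd.pYf s i).add (sd.ZYf s i)) (sd.pYf (s + 1) i) &&
    Dyad.ble ((sd.pTf s i).add (sd.ZTf s i)) (sd.pTf (s + 1) i)

/-- Unpacking the link test. [folklore] -/
theorem of_sensLinkOK {s : ℕ} (h : g.sensLinkOK sd s = true) : ∀ i < g.n,
    (sd.pYf s i).toReal + (sd.ZYf s i).toReal ≤ (sd.pYf (s + 1) i).toReal ∧
    (sd.pTf s i).toReal + (sd.ZTf s i).toReal ≤ (sd.pTf (s + 1) i).toReal := by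
  unfold sensLinkOK at h
  simp only [Bool.and_eq_true, List.all_eq_true, List.mem_range] at h
  intro i hi
  obtain ⟨h1, h2⟩ := h i hi
  have h1' := (Dyad.ble_iff _ _).1 h1
  have h2' := (Dyad.ble_iff _ _).1 h2
  rw [Dyad.toReal_add] at h1' h2'
  exact ⟨h1', h2'⟩

end GridD

namespace GridCD

variable (g : GridCD)

section Sound

variable {ι : Type*} [Fintype ι] [DecidableEq ι] {κ : Type*} [Fintype κ]

/-- **THE SENSITIVITY INVARIANT AT THE GRID TIMES.** Two runs `S_u` (realisation `Tf₁`, start `a ∈ W_0`) and `S_v`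
(realisation `Tf₂`, start `b ∈ W_0`) on `[0, T]`, `t_S ≤ T`, each with a reference run from `P_0` of its own realisation,
the realisations twins at distance `δ ≥ 0` at all times, all grid tests and all sensitivity / link tests passed, and
`|a − b|_i ≤ pY_{0,i} d`: then `|S_u(t_s) − S_v(t_s)|_i ≤ pY_{s,i} d + pT_{s,i} δ` for every `s ≤ S`.
[cite: KapelaZgliczynski2009, §4 Lemma 8 / Thm. 9; Moore1979, §8.1 eq. (8.13); cell vocabulary, harvest/h2-tao-ladder rung1/RUNG1-P2G16-REPORT.md §83] -/
theorem abs_start_sub_le_of_gridCE_sens (e : ι ≃ Fin g.n) (hn : ∀ s, (g.step s).n = g.n)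
    {Tc : ℕ → κ → BTerm ι} {Tf₁ Tf₂ : ℝ → κ → BTerm ι} {rows : ι → List κ}
    (hRDc : ∀ s ≤ g.S, IsRTEncl (g.es e hn s) (Tc s) (Tc s) rows (g.step s).RD)
    (hRD₁ : ∀ s ≤ g.S, ∀ r ∈ Ico 0 (g.h s).toReal, IsRTEncl (g.es e hn s) (Tc s) (Tf₁ (g.t s + r)) rows (g.step s).RD)
    (hRD₂ : ∀ s ≤ g.S, ∀ r ∈ Ico 0 (g.h s).toReal, IsRTEncl (g.es e hn s) (Tc s) (Tf₂ (g.t s + r)) rows (g.step s).RD)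
    (hstep : ∀ s ≤ g.S, g.stepOK s = true) (hinit : g.initOK = true) (hprod : ∀ s < g.S, g.prodOKE s = true)
    (hpwf : ∀ s ≤ g.S, g.pwfOK s = true) (hpsub : ∀ s ≤ g.S, g.psubOK s = true)
    (hplink : ∀ s < g.S, g.plinkOK s = true) (hwlink : ∀ s < g.S, g.wlinkOK s = true)
    (sd : SensD) (hsens : ∀ s ≤ g.S, g.sensStepOK sd s = true) (hlink : ∀ s < g.S, g.sensLinkOK sd s = true)
    {δ : ℝ} (hδ : 0 ≤ δ)
    (htwin : ∀ t : ℝ, ∀ k, Factor.Twin δ (Tf₁ t k).fa (Tf₂ t k).fa ∧ Factor.Twin δ (Tf₁ t k).fb (Tf₂ t k).fb)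
    {T : ℝ} (hT : g.t g.S ≤ T)
    {c₁ : ι → ℝ} (hc₁ : c₁ ∈ boxSet (boxOf e (g.P 0))) {Sc₁ : ℝ → ι → ℝ} (hSc₁0 : Sc₁ 0 = c₁)
    (hSc₁ : ∀ t ∈ Icc 0 T, HasDerivWithinAt Sc₁ (termField (Tf₁ t) (Sc₁ t)) (Icc 0 T) t)
    {c₂ : ι → ℝ} (hc₂ : c₂ ∈ boxSet (boxOf e (g.P 0))) {Sc₂ : ℝ → ι → ℝ} (hSc₂0 : Sc₂ 0 = c₂)
    (hSc₂ : ∀ t ∈ Icc 0 T, HasDerivWithinAt Sc₂ (termField (Tf₂ t) (Sc₂ t)) (Icc 0 T) t)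
    {a : ι → ℝ} (ha : a ∈ boxSet (boxOf e (g.step 0).W)) {Su : ℝ → ι → ℝ} (hSu0 : Su 0 = a)
    (hSu : ∀ t ∈ Icc 0 T, HasDerivWithinAt Su (termField (Tf₁ t) (Su t)) (Icc 0 T) t)
    {b : ι → ℝ} (hb : b ∈ boxSet (boxOf e (g.step 0).W)) {Sv : ℝ → ι → ℝ} (hSv0 : Sv 0 = b)
    (hSv : ∀ t ∈ Icc 0 T, HasDerivWithinAt Sv (termField (Tf₂ t) (Sv t)) (Icc 0 T) t)
    {dd : ℝ} (hdd : 0 ≤ dd) (h0 : ∀ i, |a i - b i| ≤ (sd.pYf 0 (e i)).toReal * dd) :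
    ∀ s ≤ g.S, ∀ i, |Su (g.t s) i - Sv (g.t s) i| ≤ (sd.pYf s (e i)).toReal * dd + (sd.pTf s (e i)).toReal * δ := by
  classical
  have hh : ∀ s ≤ g.S, 0 ≤ (g.h s).toReal := fun s hs => (g.h_nonneg_and_wfW (hstep s hs)).1
  -- hull membership of both runs (part LXIV)
  have hHu := g.traj_mem_Hs_of_gridCE e hn hRDc hRD₁ hstep hinit hprod hpwf hpsub hplink hwlink hT hc₁ hSc₁0 hSc₁ ha hSu0 hSu
  have hHv := g.traj_mem_Hs_of_gridCE e hn hRDc hRD₂ hstep hinit hprod hpwf hpsub hplink hwlink hT hc₂ hSc₂0 hSc₂ hb hSv0 hSv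
  intro s
  induction s with
  | zero =>
    intro _ i
    have hS0 := (g.step 0).of_sensOK (by simpa [GridD.sensStepOK] using hsens 0 (Nat.zero_le _))
    have hpT0 : 0 ≤ (sd.pTf 0 (e i)).toReal := by
      have := (hS0 (e i) (by rw [hn]; exact (e i).isLt)).2.2.1
      simpa [GridD.sensStepOK] using this
    simp only [GridD.t_zero, hSu0, hSv0]
    nlinarith [h0 i, mul_nonneg hpT0 hδ]
  | succ s ih =>
    intro hs i
    have hs' : s < g.S := Nat.lt_of_succ_le hs
    have hprev := ih hs'.le
    -- facts of step `s`
    have hchk : (g.step s).check = true := by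
      have := hstep s hs'.le
      simp only [GridD.stepOK, Bool.and_eq_true, decide_eq_true_eq] at this
      exact this.1
    have hc' : (g.step s).toRoughStepD.check = true ∧ (g.step s).checkPair = true := by
      simpa [PairStepD.check, Bool.and_eq_true] using hchk
    have hrc' : (g.step s).toRoughStepD.centre.check = true ∧ (g.step s).toRoughStepD.checkKZ = true := by
      simpa [RoughStepD.check, Bool.and_eq_true] using hc'.1
    obtain ⟨heta, hKZ⟩ := (g.step s).toRoughStepD.of_checkKZ hrc'.2
    have hcw := (g.step s).toRoughStepD.centre.of_checkWith (by rw [← CentreStepD.check_eq]; exact hrc'.1)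
    have hwfS : ∀ c < (g.step s).n, wfsD (IntervalD.aget (g.step s).S c) = true := fun c hc => (hcw.2.2.1 c hc).2.1
    have hZ : ∀ c < (g.step s).n, 0 ≤ (RoughStepD.dget (g.step s).Zh c).toReal := fun c hc => (hKZ c hc).1
    have hmemH : ∀ x ∈ boxSet (boxOf (g.es e hn s) (g.step s).Hs), ∀ i,
        IntervalD.mem (x i) (IntervalD.aget (g.step s).Hs (g.es e hn s i)) := fun x hx i =>
      (g.step s).toRoughStepD.mem_of_mem_Hs (g.es e hn s) hwfS hZ heta hx i
    -- times
    have ht0 : 0 ≤ g.t s := g.t_nonneg fun k hk => hh k (by omega)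
    have htsT : g.t s + (g.h s).toReal ≤ T := by
      rw [← GridD.t_succ]; exact (g.t_mono hs fun k hk => hh k (by omega)).trans hT
    have hh' : (g.h s).toReal ∈ Icc 0 (g.step s).hD.toReal := ⟨hh s hs'.le, le_rfl⟩
    -- re-clocked runs
    have hrunU : ∀ r ∈ Icc 0 (g.h s).toReal, HasDerivWithinAt (fun r => Su (g.t s + r))
        (termField (Tf₁ (g.t s + r)) (Su (g.t s + r))) (Icc 0 (g.h s).toReal) r := fun r hr =>
      hasDerivWithinAt_shift (S := Su) (S' := fun t => termField (Tf₁ t) (Su t)) hSu ht0 htsT hr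
    have hrunV : ∀ r ∈ Icc 0 (g.h s).toReal, HasDerivWithinAt (fun r => Sv (g.t s + r))
        (termField (Tf₂ (g.t s + r)) (Sv (g.t s + r))) (Icc 0 (g.h s).toReal) r := fun r hr =>
      hasDerivWithinAt_shift (S := Sv) (S' := fun t => termField (Tf₂ t) (Sv t)) hSv ht0 htsT hr
    have hmem : ∀ r ∈ Ico 0 (g.h s).toReal, Su (g.t s + r) ∈ boxSet (boxOf (g.es e hn s) (g.step s).Hs) ∧
        Sv (g.t s + r) ∈ boxSet (boxOf (g.es e hn s) (g.step s).Hs) := by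
      intro r hr
      rw [GridD.boxOf_es]
      exact ⟨hHu s hs'.le (g.t s + r) ⟨by linarith [hr.1], by linarith [hr.2]⟩ (by linarith [hr.2]),
        hHv s hs'.le (g.t s + r) ⟨by linarith [hr.1], by linarith [hr.2]⟩ (by linarith [hr.2])⟩
    have hstart : ∀ i, |Su (g.t s + 0) i - Sv (g.t s + 0) i| ≤
        (sd.pYf s (g.es e hn s i)).toReal * dd + (sd.pTf s (g.es e hn s i)).toReal * δ := by
      intro i; simp only [add_zero, GridD.es_val]; exact hprev i
    have hres := (g.step s).abs_sens_le (g.es e hn s) (hRDc s hs'.le) hh' (hRD₁ s hs'.le) (hRD₂ s hs'.le) hδ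
      (fun r _ k => htwin (g.t s + r) k) hchk (by simpa [GridD.sensStepOK] using hsens s hs'.le) hmemH hdd
      hrunU hrunV hmem hstart (g.h s).toReal ⟨hh s hs'.le, le_rfl⟩ i
    simp only [GridD.es_val] at hres
    have hlk := g.of_sensLinkOK sd (hlink s hs') (e i) (e i).isLt
    rw [GridD.t_succ]
    have hfin : Fin.mk (e i : ℕ) (by rw [hn]; exact (e i).isLt) = g.es e hn s i := Fin.ext (by simp)
    calc |Su (g.t s + (g.h s).toReal) i - Sv (g.t s + (g.h s).toReal) i|
        ≤ ((sd.pYf s (e i)).toReal + (sd.ZYf s (e i)).toReal) * dd +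
          ((sd.pTf s (e i)).toReal + (sd.ZTf s (e i)).toReal) * δ := hres
      _ ≤ (sd.pYf (s + 1) (e i)).toReal * dd + (sd.pTf (s + 1) (e i)).toReal * δ := by
          gcongr
          · exact hlk.1
          · exact hlk.2

/-- **THE TWO-RUN SENSITIVITY BOUND AT EVERY TIME OF THE GRID.** Under the hypotheses of
`abs_start_sub_le_of_gridCE_sens` and `T ≤ t_S + h_S`: for every step `s ≤ S` and every `τ ∈ [t_s, T]` with
`τ ≤ t_s + h_s`, `|S_u(τ) − S_v(τ)|_i ≤ (pY_s + ZY_s)_i d + (pT_s + ZT_s)_i δ`.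
[cite: KapelaZgliczynski2009, §4 Lemma 8 / Thm. 9; WalawskaWilczak2016, §2.2 Lemma 2; Moore1979, §8.1 eq. (8.13); cell vocabulary, harvest/h2-tao-ladder rung1/RUNG1-P2G16-REPORT.md §83 (K2)] -/
theorem abs_sub_le_of_gridCE_sens (e : ι ≃ Fin g.n) (hn : ∀ s, (g.step s).n = g.n)
    {Tc : ℕ → κ → BTerm ι} {Tf₁ Tf₂ : ℝ → κ → BTerm ι} {rows : ι → List κ}
    (hRDc : ∀ s ≤ g.S, IsRTEncl (g.es e hn s) (Tc s) (Tc s) rows (g.step s).RD)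
    (hRD₁ : ∀ s ≤ g.S, ∀ r ∈ Ico 0 (g.h s).toReal, IsRTEncl (g.es e hn s) (Tc s) (Tf₁ (g.t s + r)) rows (g.step s).RD)
    (hRD₂ : ∀ s ≤ g.S, ∀ r ∈ Ico 0 (g.h s).toReal, IsRTEncl (g.es e hn s) (Tc s) (Tf₂ (g.t s + r)) rows (g.step s).RD)
    (hstep : ∀ s ≤ g.S, g.stepOK s = true) (hinit : g.initOK = true) (hprod : ∀ s < g.S, g.prodOKE s = true)
    (hpwf : ∀ s ≤ g.S, g.pwfOK s = true) (hpsub : ∀ s ≤ g.S, g.psubOK s = true)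
    (hplink : ∀ s < g.S, g.plinkOK s = true) (hwlink : ∀ s < g.S, g.wlinkOK s = true)
    (sd : SensD) (hsens : ∀ s ≤ g.S, g.sensStepOK sd s = true) (hlink : ∀ s < g.S, g.sensLinkOK sd s = true)
    {δ : ℝ} (hδ : 0 ≤ δ)
    (htwin : ∀ t : ℝ, ∀ k, Factor.Twin δ (Tf₁ t k).fa (Tf₂ t k).fa ∧ Factor.Twin δ (Tf₁ t k).fb (Tf₂ t k).fb)
    {T : ℝ} (hT : g.t g.S ≤ T)
    {c₁ : ι → ℝ} (hc₁ : c₁ ∈ boxSet (boxOf e (g.P 0))) {Sc₁ : ℝ → ι → ℝ} (hSc₁0 : Sc₁ 0 = c₁)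
    (hSc₁ : ∀ t ∈ Icc 0 T, HasDerivWithinAt Sc₁ (termField (Tf₁ t) (Sc₁ t)) (Icc 0 T) t)
    {c₂ : ι → ℝ} (hc₂ : c₂ ∈ boxSet (boxOf e (g.P 0))) {Sc₂ : ℝ → ι → ℝ} (hSc₂0 : Sc₂ 0 = c₂)
    (hSc₂ : ∀ t ∈ Icc 0 T, HasDerivWithinAt Sc₂ (termField (Tf₂ t) (Sc₂ t)) (Icc 0 T) t)
    {a : ι → ℝ} (ha : a ∈ boxSet (boxOf e (g.step 0).W)) {Su : ℝ → ι → ℝ} (hSu0 : Su 0 = a)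
    (hSu : ∀ t ∈ Icc 0 T, HasDerivWithinAt Su (termField (Tf₁ t) (Su t)) (Icc 0 T) t)
    {b : ι → ℝ} (hb : b ∈ boxSet (boxOf e (g.step 0).W)) {Sv : ℝ → ι → ℝ} (hSv0 : Sv 0 = b)
    (hSv : ∀ t ∈ Icc 0 T, HasDerivWithinAt Sv (termField (Tf₂ t) (Sv t)) (Icc 0 T) t)
    {dd : ℝ} (hdd : 0 ≤ dd) (h0 : ∀ i, |a i - b i| ≤ (sd.pYf 0 (e i)).toReal * dd) :
    ∀ s ≤ g.S, ∀ τ ∈ Icc (g.t s) T, τ ≤ g.t s + (g.h s).toReal → ∀ i,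
      |Su τ i - Sv τ i| ≤ ((sd.pYf s (e i)).toReal + (sd.ZYf s (e i)).toReal) * dd +
        ((sd.pTf s (e i)).toReal + (sd.ZTf s (e i)).toReal) * δ := by
  classical
  intro s hs τ hτ hτh i
  have hh : ∀ s ≤ g.S, 0 ≤ (g.h s).toReal := fun s hs => (g.h_nonneg_and_wfW (hstep s hs)).1
  have hHu := g.traj_mem_Hs_of_gridCE e hn hRDc hRD₁ hstep hinit hprod hpwf hpsub hplink hwlink hT hc₁ hSc₁0 hSc₁ ha hSu0 hSu
  have hHv := g.traj_mem_Hs_of_gridCE e hn hRDc hRD₂ hstep hinit hprod hpwf hpsub hplink hwlink hT hc₂ hSc₂0 hSc₂ hb hSv0 hSv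
  have hinv := g.abs_start_sub_le_of_gridCE_sens e hn hRDc hRD₁ hRD₂ hstep hinit hprod hpwf hpsub hplink hwlink sd hsens hlink
    hδ htwin hT hc₁ hSc₁0 hSc₁ hc₂ hSc₂0 hSc₂ ha hSu0 hSu hb hSv0 hSv hdd h0 s hs
  -- facts of step `s`
  have hchk : (g.step s).check = true := by
    have := hstep s hs
    simp only [GridD.stepOK, Bool.and_eq_true, decide_eq_true_eq] at this
    exact this.1
  have hc' : (g.step s).toRoughStepD.check = true ∧ (g.step s).checkPair = true := by
    simpa [PairStepD.check, Bool.and_eq_true] using hchk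
  have hrc' : (g.step s).toRoughStepD.centre.check = true ∧ (g.step s).toRoughStepD.checkKZ = true := by
    simpa [RoughStepD.check, Bool.and_eq_true] using hc'.1
  obtain ⟨heta, hKZ⟩ := (g.step s).toRoughStepD.of_checkKZ hrc'.2
  have hcw := (g.step s).toRoughStepD.centre.of_checkWith (by rw [← CentreStepD.check_eq]; exact hrc'.1)
  have hwfS : ∀ c < (g.step s).n, wfsD (IntervalD.aget (g.step s).S c) = true := fun c hc => (hcw.2.2.1 c hc).2.1
  have hZ : ∀ c < (g.step s).n, 0 ≤ (RoughStepD.dget (g.step s).Zh c).toReal := fun c hc => (hKZ c hc).1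
  have hmemH : ∀ x ∈ boxSet (boxOf (g.es e hn s) (g.step s).Hs), ∀ i,
      IntervalD.mem (x i) (IntervalD.aget (g.step s).Hs (g.es e hn s i)) := fun x hx i =>
    (g.step s).toRoughStepD.mem_of_mem_Hs (g.es e hn s) hwfS hZ heta hx i
  -- the re-clocked runs on `[0, τ − t_s]`
  have ht0 : 0 ≤ g.t s := g.t_nonneg fun k hk => hh k (by omega)
  set h' : ℝ := τ - g.t s with hh'def
  have hh' : h' ∈ Icc 0 (g.step s).hD.toReal :=
    ⟨by simp only [hh'def]; linarith [hτ.1], by simp only [hh'def]; show τ - g.t s ≤ (g.h s).toReal; linarith⟩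
  have hτT : g.t s + h' ≤ T := by simp only [hh'def]; linarith [hτ.2]
  have hrunU : ∀ r ∈ Icc 0 h', HasDerivWithinAt (fun r => Su (g.t s + r))
      (termField (Tf₁ (g.t s + r)) (Su (g.t s + r))) (Icc 0 h') r := fun r hr =>
    hasDerivWithinAt_shift (S := Su) (S' := fun t => termField (Tf₁ t) (Su t)) hSu ht0 hτT hr
  have hrunV : ∀ r ∈ Icc 0 h', HasDerivWithinAt (fun r => Sv (g.t s + r))
      (termField (Tf₂ (g.t s + r)) (Sv (g.t s + r))) (Icc 0 h') r := fun r hr =>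
    hasDerivWithinAt_shift (S := Sv) (S' := fun t => termField (Tf₂ t) (Sv t)) hSv ht0 hτT hr
  have hmem : ∀ r ∈ Ico 0 h', Su (g.t s + r) ∈ boxSet (boxOf (g.es e hn s) (g.step s).Hs) ∧
      Sv (g.t s + r) ∈ boxSet (boxOf (g.es e hn s) (g.step s).Hs) := by
    intro r hr
    rw [GridD.boxOf_es]
    have h1 : g.t s + r ∈ Icc (g.t s) T := ⟨by linarith [hr.1], by simp only [hh'def] at hr; linarith [hr.2, hτ.2]⟩
    have h2 : g.t s + r ≤ g.t s + (g.h s).toReal := by simp only [hh'def] at hr; linarith [hr.2]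
    exact ⟨hHu s hs _ h1 h2, hHv s hs _ h1 h2⟩
  have hRD₁' : ∀ r ∈ Ico 0 h', IsRTEncl (g.es e hn s) (Tc s) (Tf₁ (g.t s + r)) rows (g.step s).RD := fun r hr =>
    hRD₁ s hs r ⟨hr.1, lt_of_lt_of_le hr.2 hh'.2⟩
  have hRD₂' : ∀ r ∈ Ico 0 h', IsRTEncl (g.es e hn s) (Tc s) (Tf₂ (g.t s + r)) rows (g.step s).RD := fun r hr =>
    hRD₂ s hs r ⟨hr.1, lt_of_lt_of_le hr.2 hh'.2⟩
  have hstart : ∀ i, |Su (g.t s + 0) i - Sv (g.t s + 0) i| ≤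
      (sd.pYf s (g.es e hn s i)).toReal * dd + (sd.pTf s (g.es e hn s i)).toReal * δ := by
    intro i; simp only [add_zero, GridD.es_val]; exact hinv i
  have hres := (g.step s).abs_sens_le (g.es e hn s) (hRDc s hs) hh' hRD₁' hRD₂' hδ
    (fun r _ k => htwin (g.t s + r) k) hchk (by simpa [GridD.sensStepOK] using hsens s hs) hmemH hdd
    hrunU hrunV hmem hstart h' ⟨hh'.1, le_rfl⟩ i
  simp only [GridD.es_val] at hres
  have e1 : g.t s + h' = τ := by simp only [hh'def]; ring
  rw [e1] at hres
  exact hres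

end Sound

end GridCD

end DSSOneShift

end Summit.NavierStokesRegularity.NavierStokesRegularity.Theorems
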